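import Literature.LinearAlgebra.Matrix.BerkowitzAlgorithm
import Literature.Computability.Complexity.CodeFPArith
import HarnessLib

/-!
# The integer determinant in polynomial time on codes (Berkowitz's algorithm modulo `4^{(L+1)²}`)

Topic `Literature/Computability/Complexity`; the machine side of
`Literature/LinearAlgebra/Matrix/BerkowitzAlgorithm.lean`. That file writes Berkowitz's
division-free algorithm (Berkowitz 1984; Soltys 2002, §2 Def. 2) as a total functional program on
lists of rows against a bare record of ring operations, proves it correct over every commutative
ring, functorial in the operations, and exact for INTEGER matrices when run with machine arithmetic
modulo `N + 1` and lifted to the balanced residue (`Berkowitz.intDet_rows`, `2 · n! · Tⁿ ≤ N`). Here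
that program is run by a polynomial-time string function in the typed `FP` algebra `CodeFP`
(`CodeFP.lean`, `CodeFPArith.lean`):

* the modular arithmetic (`addMod`, `mulMod`, `subMod`) and every sub-program of
  `Literature.LinearAlgebra.Matrix.Berkowitz` on codes — `dot_codeFP`, `matVec_codeFP`,
  `powSeq_codeFP`, `blockPowSeq_codeFP`, `newCoeff_codeFP`, `step_codeFP`, `charpolyCoeffs_codeFP`,
  `det_codeFP` — the three loops (`dot`, the power sequence, the coefficient recursion) by
  `CodeFP.foldl`, whose one hypothesis (a polynomial bound on the code of the accumulator along the
  run) holds because every stored number is a residue `≤ N` (`dot_le`, `powStep_foldl_inv`,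
  `coeffStep_foldl_inv`);
* the modulus `modulusOf A = 4^{(L+1)²} - 1` computed from the length `L` of the code of `A`
  (`modulusOf_codeFP`: two `natPow`s with unary exponents read off the code itself), the reduction of
  the entries (`zmodNat_codeFP`) and the balanced lift, assembled into
  **`detZ_codeFP : CodeFP (rawE (rawE intE)) intE detZ`**;
* **`detZ_rows : detZ (rows M) = M.det`** for every square integer matrix `M` (the entries of `M`
  are shorter than the code, `natAbs_lt_two_pow_length`, so `2 · n! · (2^L)ⁿ ≤ 4^{(L+1)²} - 1`).

So the determinant of a square integer matrix, given by the raw code of its list of rows, is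
computed exactly by a polynomial-time string function — the brick behind Cramer-rule lattice
membership tests and Gram-determinant independence tests at the machine level (e.g. the
post-processing of Regev's `GIVP ≤ DGS` reduction, Regev 2009, Lemma 3.17).

## References

* [Berkowitz1984] S. J. Berkowitz, *On computing the determinant in small parallel time using a
  small number of processors*, Inform. Process. Lett. 18 (1984) 147–150.
* [Soltys2002] M. Soltys, *Berkowitz's algorithm and clow sequences*, Electron. J. Linear Algebra 9
  (2002) 42–54, §2, Def. 2.
* [AroraBarak2009] S. Arora, B. Barak, *Computational Complexity: A Modern Approach*, CUP 2009,
  §1.3 (polynomial time is closed under composition and polynomially bounded loops).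
-/

namespace Literature.Computability.Complexity

namespace IntDetFP

open CodeFP Polynomial _root_.Computability Brick Literature.LinearAlgebra.Matrix
  Literature.LinearAlgebra.Matrix.Berkowitz

/-! ### Encoders -/

/-- Vectors of naturals: raw lists of binary numerals. -/
local notation "vecE" => rawE natE

/-- Matrices of naturals: raw lists of rows. -/
local notation "matE" => rawE (rawE natE)

/-- Integer matrices: raw lists of rows of canonical integer codes. -/
local notation "zmatE" => rawE (rawE intE)

/-! ### Length bookkeeping -/

/-- Binary numerals have `Nat.size` bits. [folklore] -/
theorem length_natE_eq_size (n : ℕ) : (natE n).length = n.size := TM2Pass.length_encodeNat_eq_size n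

/-- The length of binary numerals is monotone. [folklore] -/
theorem length_natE_mono {a b : ℕ} (h : a ≤ b) : (natE a).length ≤ (natE b).length := by
  rw [length_natE_eq_size, length_natE_eq_size]; exact Nat.size_le_size h

/-- The raw code of a list of naturals bounded by `B`. [folklore] -/
theorem length_rawE_natE_le {l : List ℕ} {B : ℕ} (h : ∀ x ∈ l, x ≤ B) :
    (rawE natE l).length ≤ l.length * (2 * (natE B).length + 2) := by
  induction l with
  | nil => simp
  | cons a l ih =>
    rw [rawE_cons, length_boolPair, List.length_cons, add_mul, one_mul]
    have ha := length_natE_mono (h a List.mem_cons_self)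
    have hl := ih fun x hx => h x (List.mem_cons_of_mem a hx)
    omega

/-- The raw code of a list of units has length `2 |l|`. [folklore] -/
theorem length_rawE_unitE (l : List Unit) : (rawE unitE l).length = 2 * l.length := by
  induction l with
  | nil => simp
  | cons a l ih => rw [rawE_cons, length_boolPair, List.length_cons, ih]; simp [unitE]; ring

/-! ### Values of the modular operations are residues -/

/-- `(a + b) mod (N+1) ≤ N`. [folklore] -/
theorem add_le (N a b : ℕ) : (RingOps.modSucc N).add a b ≤ N := Nat.lt_succ_iff.1 (Nat.mod_lt _ N.succ_pos)

/-- `(a b) mod (N+1) ≤ N`. [folklore] -/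
theorem mul_le (N a b : ℕ) : (RingOps.modSucc N).mul a b ≤ N := Nat.lt_succ_iff.1 (Nat.mod_lt _ N.succ_pos)

/-- `(a - b) mod (N+1) ≤ N`. [folklore] -/
theorem sub_le (N a b : ℕ) : (RingOps.modSucc N).sub a b ≤ N := Nat.lt_succ_iff.1 (Nat.mod_lt _ N.succ_pos)

/-- `1 mod (N+1) ≤ N`. [folklore] -/
theorem one_le (N : ℕ) : (RingOps.modSucc N).one ≤ N := Nat.lt_succ_iff.1 (Nat.mod_lt _ N.succ_pos)

/-- A left fold of modular additions from a residue stays a residue. [folklore] -/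
theorem foldl_add_le (N : ℕ) (l : List ℕ) {a : ℕ} (ha : a ≤ N) :
    l.foldl (RingOps.modSucc N).add a ≤ N := by
  induction l generalizing a with
  | nil => exact ha
  | cons x l ih => exact ih (add_le N a x)

/-- `dot` modulo `N + 1` is a residue. [folklore] -/
theorem dot_le (N : ℕ) (u v : List ℕ) : dot (RingOps.modSucc N) u v ≤ N :=
  foldl_add_le N _ (Nat.zero_le N)

/-- `matVec` has one entry per row. [folklore] -/
theorem length_matVec (N : ℕ) (M : List (List ℕ)) (v : List ℕ) :
    (matVec (RingOps.modSucc N) M v).length = M.length := by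
  simp [matVec]

/-- `matVec` modulo `N + 1` has residue entries. [folklore] -/
theorem matVec_le (N : ℕ) (M : List (List ℕ)) (v : List ℕ) :
    ∀ x ∈ matVec (RingOps.modSucc N) M v, x ≤ N := by
  intro x hx
  rw [matVec, List.mem_map] at hx
  obtain ⟨row, -, rfl⟩ := hx
  exact dot_le N row v

/-- Invariant of the power fold from `(S, [])`: the vector is `S` or a residue vector with one entry
per row of `M`, and the number list has one residue per step. [folklore] -/
theorem powStep_foldl_inv (N : ℕ) (M : List (List ℕ)) (R S : List ℕ) (l : List Unit) :
    let p := l.foldl (fun acc u => powStep (RingOps.modSucc N) M R acc u) (S, [])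
    (p.1 = S ∨ (p.1.length = M.length ∧ ∀ x ∈ p.1, x ≤ N)) ∧ p.2.length = l.length ∧ ∀ x ∈ p.2, x ≤ N := by
  induction l using List.reverseRecOn with
  | nil => simp
  | append_singleton l u ih =>
    simp only [List.foldl_append, List.foldl_cons, List.foldl_nil, List.length_append,
      List.length_singleton]
    set p := l.foldl (fun acc u => powStep (RingOps.modSucc N) M R acc u) (S, [])
    obtain ⟨-, h2, h3⟩ := ih
    refine ⟨Or.inr ⟨length_matVec N M p.1, matVec_le N M p.1⟩, by simp [powStep, h2], ?_⟩
    intro x hx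
    simp only [powStep, List.mem_append, List.mem_singleton] at hx
    rcases hx with hx | rfl
    · exact h3 x hx
    · exact dot_le N _ _

/-- The step produces `r + 2` residues. [folklore] -/
theorem length_step (N : ℕ) (A : List (List ℕ)) (c : List ℕ) (r : ℕ) :
    (step (RingOps.modSucc N) A c r).length = r + 2 := by
  simp [step]

/-- Invariant of the coefficient fold from `(0, [1])`: the counter is the number of steps and the
coefficient list has at most one more residue than that. [folklore] -/
theorem coeffStep_foldl_inv (N : ℕ) (A : List (List ℕ)) (l : List Unit) :
    let p := l.foldl (fun acc u => coeffStep (RingOps.modSucc N) A acc u) (0, [(RingOps.modSucc N).one])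
    p.1 = l.length ∧ p.2.length ≤ l.length + 1 ∧ ∀ x ∈ p.2, x ≤ N := by
  induction l using List.reverseRecOn with
  | nil => simpa using one_le N
  | append_singleton l u ih =>
    simp only [List.foldl_append, List.foldl_cons, List.foldl_nil, List.length_append,
      List.length_singleton]
    set p := l.foldl (fun acc u => coeffStep (RingOps.modSucc N) A acc u) (0, [(RingOps.modSucc N).one])
    obtain ⟨h1, -, -⟩ := ih
    refine ⟨by simp [coeffStep, h1], ?_, ?_⟩
    · simp only [coeffStep, length_step]; omega
    · intro x hx
      exact Nat.lt_succ_iff.1 (step_modSucc_lt N A p.2 p.1 x hx)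

/-! ### The modular arithmetic on codes -/

/-- `(N, a, b) ↦ (a + b) mod (N + 1)` on binary numerals. [cite: AroraBarak2009, §1.3] -/
theorem addMod_codeFP :
    CodeFP (pairE natE (pairE natE natE)) natE (fun t => (RingOps.modSucc t.1).add t.2.1 t.2.2) :=
  (natMod.comp ((natAdd.comp (snd natE (pairE natE natE))).pair
    (natAdd.comp ((fst natE (pairE natE natE)).pair (const _ 1))))).congr fun _ => rfl

/-- `(N, a, b) ↦ (a b) mod (N + 1)` on binary numerals. [cite: AroraBarak2009, §1.3] -/
theorem mulMod_codeFP :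
    CodeFP (pairE natE (pairE natE natE)) natE (fun t => (RingOps.modSucc t.1).mul t.2.1 t.2.2) :=
  (natMod.comp ((natMul.comp (snd natE (pairE natE natE))).pair
    (natAdd.comp ((fst natE (pairE natE natE)).pair (const _ 1))))).congr fun _ => rfl

/-- `(N, a, b) ↦ (a - b) mod (N + 1)` on binary numerals (as `(a + ((N+1) - b mod (N+1))) mod (N+1)`).
[cite: AroraBarak2009, §1.3] -/
theorem subMod_codeFP :
    CodeFP (pairE natE (pairE natE natE)) natE (fun t => (RingOps.modSucc t.1).sub t.2.1 t.2.2) := by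
  have hN1 : CodeFP (pairE natE (pairE natE natE)) natE (fun t => t.1 + 1) :=
    natAdd.comp ((fst natE (pairE natE natE)).pair (const _ 1))
  have hb : CodeFP (pairE natE (pairE natE natE)) natE (fun t => t.2.2 % (t.1 + 1)) :=
    natMod.comp ((snd natE (pairE natE natE)).snd'.pair hN1)
  have h : CodeFP (pairE natE (pairE natE natE)) natE
      (fun t => (t.2.1 + (t.1 + 1 - t.2.2 % (t.1 + 1))) % (t.1 + 1)) :=
    natMod.comp ((natAdd.comp ((snd natE (pairE natE natE)).fst'.pair (natSub.comp (hN1.pair hb)))).pair hN1)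
  exact h.congr fun _ => rfl

/-- `N ↦ 1 mod (N + 1)`. [cite: AroraBarak2009, §1.3] -/
theorem oneMod_codeFP : CodeFP natE natE (fun N => (RingOps.modSucc N).one) :=
  (natMod.comp ((const natE 1).pair (natAdd.comp ((CodeFP.id natE).pair (const _ 1))))).congr fun _ => rfl

/-! ### The sub-programs on codes -/

/-- **`dot` on codes** (`zipWith` then a left fold of modular additions; the accumulator is a
residue, so its code is no longer than that of `N`). [cite: AroraBarak2009, §1.3] -/
theorem dot_codeFP :
    CodeFP (pairE natE (pairE vecE vecE)) natE (fun t => dot (RingOps.modSucc t.1) t.2.1 t.2.2) := by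
  have hzip : CodeFP (pairE natE (pairE vecE vecE)) vecE
      (fun t => List.zipWith (fun a b => (RingOps.modSucc t.1).mul a b) t.2.1 t.2.2) :=
    zipWith (g := fun t : ℕ × ℕ × ℕ => (RingOps.modSucc t.1).mul t.2.1 t.2.2) mulMod_codeFP
  have hstep : CodeFP (pairE natE (pairE natE natE)) natE (fun t => (RingOps.modSucc t.1).add t.2.2 t.2.1) :=
    addMod_codeFP.comp ((fst natE (pairE natE natE)).pair
      ((snd natE (pairE natE natE)).snd'.pair (snd natE (pairE natE natE)).fst'))
  have hinit : CodeFP natE natE (fun N => (RingOps.modSucc N).zero) := (const natE 0).congr fun _ => rfl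
  have hfold := foldl (σ := ℕ) (α := ℕ) (β := ℕ) (eσ := natE) (eα := natE) (eβ := natE)
    (step := fun N a b => (RingOps.modSucc N).add b a) (init := fun N => (RingOps.modSucc N).zero)
    hstep hinit X (fun N l₁ l₂ => by
      have h := length_natE_mono (foldl_add_le N l₁ (a := (RingOps.modSucc N).zero) (Nat.zero_le N))
      change (natE (l₁.foldl (RingOps.modSucc N).add (RingOps.modSucc N).zero)).length ≤
        X.eval (boolPair (natE N) (rawE natE (l₁ ++ l₂))).length
      rw [eval_X, length_boolPair]
      omega)
  exact (hfold.comp ((fst natE (pairE vecE vecE)).pair hzip)).congr fun _ => rfl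

/-- **`matVec` on codes** (a `map` of `dot` over the rows). [cite: AroraBarak2009, §1.3] -/
theorem matVec_codeFP :
    CodeFP (pairE natE (pairE matE vecE)) vecE (fun t => matVec (RingOps.modSucc t.1) t.2.1 t.2.2) := by
  have hg : CodeFP (pairE (pairE natE vecE) vecE) natE (fun q => dot (RingOps.modSucc q.1.1) q.2 q.1.2) :=
    dot_codeFP.comp ((fst (pairE natE vecE) vecE).fst'.pair
      ((snd (pairE natE vecE) vecE).pair (fst (pairE natE vecE) vecE).snd'))
  have hmap := map (σ := ℕ × List ℕ) (eσ := pairE natE vecE) (eα := vecE) hg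
  exact (hmap.comp (((fst natE (pairE matE vecE)).pair (snd natE (pairE matE vecE)).snd').pair
    (snd natE (pairE matE vecE)).fst')).congr fun _ => rfl

/-- The context of the power fold: `(N, M, R, S)`. -/
local notation "powCtxE" => pairE natE (pairE (rawE (rawE natE)) (pairE (rawE natE) (rawE natE)))

/-- **The power fold on codes**: `|l|` steps of `powStep` from `(S, [])`; the accumulator is a pair
(residue vector with one entry per row of `M` or `S` itself, list of `≤ |l|` residues), so its code
is quadratically bounded. [cite: AroraBarak2009, §1.3] -/
theorem powFold_codeFP :
    CodeFP (pairE powCtxE (rawE unitE)) (pairE vecE vecE)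
      (fun p => p.2.foldl (fun acc u => powStep (RingOps.modSucc p.1.1) p.1.2.1 p.1.2.2.1 acc u) (p.1.2.2.2, [])) := by
  -- the step `((N, M, R, S), u, (s, q)) ↦ (matVec N M s, q ++ [dot N R s])`
  let tE := pairE powCtxE (pairE unitE (pairE vecE vecE))
  have pN : CodeFP tE natE (fun t => t.1.1) := (fst _ _).fst'
  have pM : CodeFP tE matE (fun t => t.1.2.1) := (fst _ _).snd'.fst'
  have pR : CodeFP tE vecE (fun t => t.1.2.2.1) := (fst _ _).snd'.snd'.fst'
  have ps : CodeFP tE vecE (fun t => t.2.2.1) := (snd _ _).snd'.fst'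
  have pq : CodeFP tE vecE (fun t => t.2.2.2) := (snd _ _).snd'.snd'
  have hmv : CodeFP tE vecE (fun t => matVec (RingOps.modSucc t.1.1) t.1.2.1 t.2.2.1) :=
    matVec_codeFP.comp (pN.pair (pM.pair ps))
  have hdot : CodeFP tE natE (fun t => dot (RingOps.modSucc t.1.1) t.1.2.2.1 t.2.2.1) :=
    dot_codeFP.comp (pN.pair (pR.pair ps))
  have hstep : CodeFP tE (pairE vecE vecE)
      (fun t => powStep (RingOps.modSucc t.1.1) t.1.2.1 t.1.2.2.1 t.2.2 t.2.1) :=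
    (hmv.pair ((rawAppend natE).comp (pq.pair ((rawSingleton natE).comp hdot)))).congr fun _ => rfl
  have hinit : CodeFP powCtxE (pairE vecE vecE) (fun s => (s.2.2.2, ([] : List ℕ))) :=
    (snd _ _).snd'.snd'.pair (const _ [])
  refine foldl (σ := ℕ × List (List ℕ) × List ℕ × List ℕ) (α := Unit) (β := List ℕ × List ℕ)
    (eσ := powCtxE) (eα := unitE) (eβ := pairE vecE vecE)
    (step := fun s u acc => powStep (RingOps.modSucc s.1) s.2.1 s.2.2.1 acc u)
    (init := fun s => (s.2.2.2, [])) hstep hinit (6 * X * X + 8 * X + 8) fun s l₁ l₂ => ?_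
  obtain ⟨N, M, R, S⟩ := s
  have hinv := powStep_foldl_inv N M R S l₁
  simp only at hinv
  obtain ⟨h1, h2, h3⟩ := hinv
  set p := l₁.foldl (fun acc u => powStep (RingOps.modSucc N) M R acc u) (S, [])
  -- sizes of the input
  set W := (pairE powCtxE (rawE unitE) ((N, M, R, S), l₁ ++ l₂)).length with hW
  have hWN : (natE N).length ≤ W := by
    simp only [hW, pairE_apply, length_boolPair]; omega
  have hWM : M.length ≤ W := by
    have := length_le_length_rawE (rawE natE) M
    simp only [hW, pairE_apply, length_boolPair]; omega
  have hWS : (rawE natE S).length ≤ W := by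
    simp only [hW, pairE_apply, length_boolPair]; omega
  have hWl : 2 * l₁.length ≤ W := by
    have := length_rawE_unitE (l₁ ++ l₂)
    simp only [hW, pairE_apply, length_boolPair, List.length_append] at this ⊢; omega
  -- the accumulator
  have hp1 : (rawE natE p.1).length ≤ W + W * (2 * W + 2) := by
    rcases h1 with h1 | ⟨h1l, h1b⟩
    · rw [h1]; nlinarith [hWS]
    · have := length_rawE_natE_le h1b
      rw [h1l] at this
      nlinarith [this, hWM, hWN]
  have hp2 : (rawE natE p.2).length ≤ W * (2 * W + 2) := by
    have := length_rawE_natE_le h3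
    rw [h2] at this
    nlinarith [this, hWl, hWN]
  simp only [eval_add, eval_mul, eval_X, eval_ofNat, pairE_apply, length_boolPair]
  change 2 * (rawE natE p.1).length + 2 + (rawE natE p.2).length ≤ 6 * W * W + 8 * W + 8
  nlinarith [hp1, hp2]

/-- **`powSeq` on codes**. [cite: Soltys2002, §2 Def. 2] [cite: AroraBarak2009, §1.3] -/
theorem powSeq_codeFP :
    CodeFP (pairE natE (pairE matE (pairE vecE (pairE vecE unE)))) vecE
      (fun t => powSeq (RingOps.modSucc t.1) t.2.1 t.2.2.1 t.2.2.2.1 t.2.2.2.2) := by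
  let iE := pairE natE (pairE matE (pairE vecE (pairE vecE unE)))
  have hctx : CodeFP iE powCtxE (fun t => (t.1, t.2.1, t.2.2.1, t.2.2.2.1)) :=
    (fst _ _).pair ((snd _ _).fst'.pair ((snd _ _).snd'.fst'.pair (snd _ _).snd'.snd'.fst'))
  have hrep : CodeFP iE (rawE unitE) (fun t => List.replicate t.2.2.2.2 ()) :=
    replicateUnit.comp (snd _ _).snd'.snd'.snd'
  exact ((powFold_codeFP.comp (hctx.pair hrep)).snd').congr fun _ => rfl

/-- **`blockPowSeq` on codes** (cut `A` to the leading block, its border row and column, then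
`powSeq`). [cite: Soltys2002, §2 Def. 2] [cite: AroraBarak2009, §1.3] -/
theorem blockPowSeq_codeFP :
    CodeFP (pairE natE (pairE matE unE)) vecE (fun t => blockPowSeq (RingOps.modSucc t.1) t.2.1 t.2.2) := by
  let iE := pairE natE (pairE matE unE)
  have pN : CodeFP iE natE (fun t => t.1) := fst _ _
  have pA : CodeFP iE matE (fun t => t.2.1) := (snd _ _).fst'
  have pr : CodeFP iE unE (fun t => t.2.2) := (snd _ _).snd'
  have prN : CodeFP iE natE (fun t => t.2.2) := natOfUn.comp pr
  have hAr : CodeFP iE matE (fun t => t.2.1.take t.2.2) := (rawTakeUn (rawE natE)).comp (pr.pair pA)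
  have hM : CodeFP iE matE (fun t => (t.2.1.take t.2.2).map (·.take t.2.2)) :=
    (map (σ := ℕ) (eσ := unE) (eα := vecE) (g := fun q : ℕ × List ℕ => q.2.take q.1)
      (rawTakeUn natE)).comp (pr.pair hAr)
  have hrow : CodeFP iE vecE (fun t => t.2.1.getD t.2.2 []) :=
    (rawGetD (rawE natE) (d := []) rfl).comp (pA.pair prN)
  have hR : CodeFP iE vecE (fun t => (t.2.1.getD t.2.2 []).take t.2.2) := (rawTakeUn natE).comp (pr.pair hrow)
  have hS : CodeFP iE vecE (fun t => (t.2.1.take t.2.2).map (·.getD t.2.2 0)) :=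
    (map (σ := ℕ) (eσ := natE) (eα := vecE) (g := fun q : ℕ × List ℕ => q.2.getD q.1 0)
      ((rawGetD natE (d := 0) natE_zero).comp ((snd natE vecE).pair (fst natE vecE)))).comp (prN.pair hAr)
  exact (powSeq_codeFP.comp (pN.pair (hM.pair (hR.pair (hS.pair pr))))).congr fun _ => rfl

/-- Dropping at least the whole list is dropping the whole list. [folklore] -/
theorem drop_min_length {α : Type*} (l : List α) (k : ℕ) : l.drop (min k l.length) = l.drop k := by
  rcases le_total k l.length with h | h
  · rw [min_eq_left h]
  · rw [min_eq_right h, List.drop_length, List.drop_eq_nil_of_le h]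

/-- **`newCoeff` on codes** (one entry of Berkowitz's Toeplitz row). [cite: Soltys2002, §2 Def. 2]
[cite: AroraBarak2009, §1.3] -/
theorem newCoeff_codeFP :
    CodeFP (pairE natE (pairE vecE (pairE vecE (pairE natE natE)))) natE
      (fun t => newCoeff (RingOps.modSucc t.1) t.2.1 t.2.2.1 t.2.2.2.1 t.2.2.2.2) := by
  let iE := pairE natE (pairE vecE (pairE vecE (pairE natE natE)))
  have pN : CodeFP iE natE (fun t => t.1) := fst _ _
  have pc : CodeFP iE vecE (fun t => t.2.1) := (snd _ _).fst'
  have pq : CodeFP iE vecE (fun t => t.2.2.1) := (snd _ _).snd'.fst'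
  have pa : CodeFP iE natE (fun t => t.2.2.2.1) := (snd _ _).snd'.snd'.fst'
  have pl : CodeFP iE natE (fun t => t.2.2.2.2) := (snd _ _).snd'.snd'.snd'
  -- `c_{l-1}` (or `0` at `l = 0`), `c_l`
  have hget1 : CodeFP iE natE (fun t => t.2.1.getD (t.2.2.2.2 - 1) 0) :=
    (rawGetD natE (d := 0) natE_zero).comp (pc.pair (natSub.comp (pl.pair (const _ 1))))
  have hzero : CodeFP iE bitE (fun t => decide (t.2.2.2.2 = 0)) := natEq.comp (pl.pair (const _ 0))
  have hterm1 : CodeFP iE natE (fun t => if decide (t.2.2.2.2 = 0) then (0 : ℕ) else t.2.1.getD (t.2.2.2.2 - 1) 0) :=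
    hzero.ite (const _ 0) hget1
  have hget2 : CodeFP iE natE (fun t => t.2.1.getD t.2.2.2.2 0) :=
    (rawGetD natE (d := 0) natE_zero).comp (pc.pair pl)
  have hterm2 : CodeFP iE natE (fun t => (RingOps.modSucc t.1).mul t.2.2.2.1 (t.2.1.getD t.2.2.2.2 0)) :=
    mulMod_codeFP.comp (pN.pair (pa.pair hget2))
  -- `dot (c.drop (l+1)) q`, the drop index made unary under the cap `|c|`
  have hlen : CodeFP iE unE (fun t => t.2.1.length) := (ulength natE).comp pc
  have hidx : CodeFP iE unE (fun t => min (t.2.2.2.2 + 1) t.2.1.length) :=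
    unOfNatMin.comp (hlen.pair (natAdd.comp (pl.pair (const _ 1))))
  have hdrop : CodeFP iE vecE (fun t => t.2.1.drop (min (t.2.2.2.2 + 1) t.2.1.length)) :=
    (rawDropUn natE).comp (hidx.pair pc)
  have hterm3 : CodeFP iE natE (fun t => dot (RingOps.modSucc t.1) (t.2.1.drop (min (t.2.2.2.2 + 1) t.2.1.length)) t.2.2.1) :=
    dot_codeFP.comp (pN.pair (hdrop.pair pq))
  have h := subMod_codeFP.comp (pN.pair ((subMod_codeFP.comp (pN.pair (hterm1.pair hterm2))).pair hterm3))
  refine h.congr fun t => ?_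
  dsimp only
  rw [newCoeff, drop_min_length]
  by_cases hl : t.2.2.2.2 = 0
  · rw [if_pos (decide_eq_true hl), if_pos hl]; rfl
  · rw [if_neg (by rw [decide_eq_true_iff]; exact hl), if_neg hl]; rfl

/-- **One step on codes** (`map` of `newCoeff` over `range (r + 2)`). [cite: Soltys2002, §2 Def. 2]
[cite: AroraBarak2009, §1.3] -/
theorem step_codeFP :
    CodeFP (pairE natE (pairE matE (pairE vecE unE))) vecE
      (fun t => step (RingOps.modSucc t.1) t.2.1 t.2.2.1 t.2.2.2) := by
  let iE := pairE natE (pairE matE (pairE vecE unE))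
  have pN : CodeFP iE natE (fun t => t.1) := fst _ _
  have pA : CodeFP iE matE (fun t => t.2.1) := (snd _ _).fst'
  have pc : CodeFP iE vecE (fun t => t.2.2.1) := (snd _ _).snd'.fst'
  have pr : CodeFP iE unE (fun t => t.2.2.2) := (snd _ _).snd'.snd'
  have prN : CodeFP iE natE (fun t => t.2.2.2) := natOfUn.comp pr
  have hq : CodeFP iE vecE (fun t => blockPowSeq (RingOps.modSucc t.1) t.2.1 t.2.2.2) :=
    blockPowSeq_codeFP.comp (pN.pair (pA.pair pr))
  have ha : CodeFP iE natE (fun t => (t.2.1.getD t.2.2.2 []).getD t.2.2.2 0) :=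
    (rawGetD natE (d := 0) natE_zero).comp (((rawGetD (rawE natE) (d := []) rfl).comp (pA.pair prN)).pair prN)
  have hrange : CodeFP iE (rawE natE) (fun t => List.range (t.2.2.2 + 2)) :=
    urange.comp (unSucc.comp (unSucc.comp pr))
  -- context `(N, c, q, a)`, item `l`
  let cE := pairE natE (pairE vecE (pairE vecE natE))
  have hctx : CodeFP iE cE (fun t => (t.1, t.2.2.1, blockPowSeq (RingOps.modSucc t.1) t.2.1 t.2.2.2,
      (t.2.1.getD t.2.2.2 []).getD t.2.2.2 0)) := pN.pair (pc.pair (hq.pair ha))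
  have hg := newCoeff_codeFP.comp ((fst cE natE).fst'.pair ((fst cE natE).snd'.fst'.pair
      ((fst cE natE).snd'.snd'.fst'.pair ((fst cE natE).snd'.snd'.snd'.pair (snd cE natE)))))
  have hmap := map (σ := ℕ × List ℕ × List ℕ × ℕ) (eσ := cE) (eα := natE) hg
  have hfinal := hmap.comp (hctx.pair hrange)
  exact hfinal.congr fun _ => rfl

/-- **The coefficient fold on codes**: `|l|` steps of `coeffStep` from `(0, [1])`; the accumulator
is (unary counter `≤ |l|`, at most `|l| + 1` residues). [cite: Berkowitz1984, §2] [cite: AroraBarak2009, §1.3] -/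
theorem coeffFold_codeFP :
    CodeFP (pairE (pairE natE matE) (rawE unitE)) (pairE unE vecE)
      (fun p => p.2.foldl (fun acc u => coeffStep (RingOps.modSucc p.1.1) p.1.2 acc u)
        (0, [(RingOps.modSucc p.1.1).one])) := by
  let tE := pairE (pairE natE matE) (pairE unitE (pairE unE vecE))
  have pN : CodeFP tE natE (fun t => t.1.1) := (fst _ _).fst'
  have pA : CodeFP tE matE (fun t => t.1.2) := (fst _ _).snd'
  have pk : CodeFP tE unE (fun t => t.2.2.1) := (snd _ _).snd'.fst'
  have pc : CodeFP tE vecE (fun t => t.2.2.2) := (snd _ _).snd'.snd'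
  have hstep : CodeFP tE (pairE unE vecE)
      (fun t => coeffStep (RingOps.modSucc t.1.1) t.1.2 t.2.2 t.2.1) :=
    ((unSucc.comp pk).pair (step_codeFP.comp (pN.pair (pA.pair (pc.pair pk))))).congr fun _ => rfl
  have hinit : CodeFP (pairE natE matE) (pairE unE vecE) (fun s => ((0 : ℕ), [(RingOps.modSucc s.1).one])) :=
    (const _ 0).pair ((rawSingleton natE).comp (oneMod_codeFP.comp (fst _ _)))
  refine foldl (σ := ℕ × List (List ℕ)) (α := Unit) (β := ℕ × List ℕ) (eσ := pairE natE matE)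
    (eα := unitE) (eβ := pairE unE vecE)
    (step := fun s u acc => coeffStep (RingOps.modSucc s.1) s.2 acc u)
    (init := fun s => (0, [(RingOps.modSucc s.1).one])) hstep hinit (4 * X * X + 8 * X + 8) fun s l₁ l₂ => ?_
  obtain ⟨N, A⟩ := s
  have hinv := coeffStep_foldl_inv N A l₁
  simp only at hinv
  obtain ⟨h1, h2, h3⟩ := hinv
  set p := l₁.foldl (fun acc u => coeffStep (RingOps.modSucc N) A acc u) (0, [(RingOps.modSucc N).one])
  set W := (pairE (pairE natE matE) (rawE unitE) ((N, A), l₁ ++ l₂)).length with hW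
  have hWN : (natE N).length ≤ W := by
    simp only [hW, pairE_apply, length_boolPair]; omega
  have hWl : 2 * l₁.length ≤ W := by
    have := length_rawE_unitE (l₁ ++ l₂)
    simp only [hW, pairE_apply, length_boolPair, List.length_append] at this ⊢; omega
  have hp2 : (rawE natE p.2).length ≤ 2 * W * W + 4 * W + 2 := by
    have := length_rawE_natE_le h3
    have h2' : p.2.length ≤ W + 1 := by omega
    nlinarith [this, h2', hWN]
  have hp1 : (unE p.1).length ≤ W := by rw [h1, length_unE]; omega
  simp only [eval_add, eval_mul, eval_X, eval_ofNat, pairE_apply, length_boolPair]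
  change 2 * (unE p.1).length + 2 + (rawE natE p.2).length ≤ 4 * W * W + 8 * W + 8
  nlinarith [hp1, hp2]

/-- **`charpolyCoeffs` on codes**. [cite: Berkowitz1984, §2] [cite: AroraBarak2009, §1.3] -/
theorem charpolyCoeffs_codeFP :
    CodeFP (pairE natE matE) vecE (fun t => charpolyCoeffs (RingOps.modSucc t.1) t.2) := by
  have hrep : CodeFP (pairE natE matE) (rawE unitE) (fun t => List.replicate t.2.length ()) :=
    replicateUnit.comp ((ulength (rawE natE)).comp (snd _ _))
  exact ((coeffFold_codeFP.comp ((CodeFP.id _).pair hrep)).snd').congr fun _ => rfl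

/-- **The modular determinant on codes** (`(-1)ⁿ c₀`). [cite: Berkowitz1984, §2] [cite: AroraBarak2009, §1.3] -/
theorem det_codeFP :
    CodeFP (pairE natE matE) natE (fun t => Berkowitz.det (RingOps.modSucc t.1) t.2) := by
  have hc0 : CodeFP (pairE natE matE) natE (fun t => (charpolyCoeffs (RingOps.modSucc t.1) t.2).getD 0 0) :=
    ((rawGetD natE (d := 0) natE_zero).comp (charpolyCoeffs_codeFP.pair (const _ 0))).congr fun _ => rfl
  have hpar : CodeFP (pairE natE matE) bitE (fun t => decide (t.2.length % 2 = 0)) :=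
    (natEq.comp ((natMod.comp (((natLength (rawE natE)).comp (snd _ _)).pair (const _ 2))).pair
      (const _ 0))).congr fun _ => rfl
  have hneg : CodeFP (pairE natE matE) natE
      (fun t => (RingOps.modSucc t.1).sub (RingOps.modSucc t.1).zero
        ((charpolyCoeffs (RingOps.modSucc t.1) t.2).getD 0 0)) :=
    (subMod_codeFP.comp ((fst _ _).pair ((const _ 0).pair hc0))).congr fun _ => rfl
  refine (hpar.ite hc0 hneg).congr fun t => ?_
  rw [Berkowitz.det]
  by_cases h : t.2.length % 2 = 0
  · rw [if_pos (decide_eq_true h), if_pos h]; rfl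
  · rw [if_neg (by rw [decide_eq_true_iff]; exact h), if_neg h]; rfl

/-! ### Reduction of integer entries, the modulus, the lift -/

/-- `(N, z) ↦ z mod (N + 1)` as a natural number (`z % m = z - m (z / m)`). [cite: AroraBarak2009, §1.3] -/
theorem zmodNat_codeFP : CodeFP (pairE natE intE) natE (fun t => zmodNat t.1 t.2) := by
  have hm : CodeFP (pairE natE intE) intE (fun t => ((t.1 : ℤ) + 1)) :=
    (intAdd.comp ((intOfNat.comp (fst _ _)).pair (const _ (1 : ℤ)))).congr fun _ => rfl
  have hz : CodeFP (pairE natE intE) intE (fun t => t.2) := snd _ _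
  have hmod : CodeFP (pairE natE intE) intE (fun t => t.2 - ((t.1 : ℤ) + 1) * (t.2 / ((t.1 : ℤ) + 1))) :=
    (intSub.comp (hz.pair (intMul.comp (hm.pair (intEDiv.comp (hz.pair hm)))))).congr fun _ => rfl
  refine ((intToNat.comp hmod).congr fun t => ?_)
  rw [zmodNat, Int.emod_def]

/-- Reduction of all entries: `A ↦ (zmodNat N ∘∘ A)`. [cite: AroraBarak2009, §1.3] -/
theorem reduce_codeFP :
    CodeFP (pairE natE zmatE) matE (fun t => t.2.map (·.map (zmodNat t.1))) := by
  have hrow : CodeFP (pairE natE (rawE intE)) vecE (fun q => q.2.map (zmodNat q.1)) :=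
    map (σ := ℕ) (eσ := natE) (eα := intE) zmodNat_codeFP
  have h := map (σ := ℕ) (eσ := natE) (eα := rawE intE) (g := fun q : ℕ × List ℤ => q.2.map (zmodNat q.1))
    (hrow.comp ((fst natE (rawE intE)).pair (snd natE (rawE intE))))
  exact h.congr fun _ => rfl

/-- The length of the code of an integer matrix. [folklore] -/
def codeLen (A : List (List ℤ)) : ℕ := (zmatE A).length

/-- **The modulus** read off the size of the code: `4^{(L+1)²} - 1`, `L = |code A|`. [folklore] -/
def modulusOf (A : List (List ℤ)) : ℕ := 4 ^ ((codeLen A + 1) * (codeLen A + 1)) - 1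

/-- The code length in unary is computed by overwriting every symbol with `1`. [folklore] -/
theorem codeLen_codeFP : CodeFP zmatE unE codeLen := ⟨onesFn, onesFn_mem_FP, fun _ => rfl⟩

/-- **The modulus on codes** (two powers with unary exponents). [cite: AroraBarak2009, §1.3] -/
theorem modulusOf_codeFP : CodeFP zmatE natE modulusOf := by
  have hL1 : CodeFP zmatE unE (fun A => codeLen A + 1) := unSucc.comp codeLen_codeFP
  have hP : CodeFP zmatE natE (fun A => 4 ^ (codeLen A + 1)) := natPow.comp ((const _ 4).pair hL1)
  have hPP : CodeFP zmatE natE (fun A => (4 ^ (codeLen A + 1)) ^ (codeLen A + 1)) := natPow.comp (hP.pair hL1)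
  refine ((natSub.comp (hPP.pair (const _ 1))).congr fun A => ?_)
  rw [modulusOf, ← pow_mul]

/-- **The integer determinant computed on codes**: reduce modulo `N + 1` for the modulus `N` read
off the code, run Berkowitz's program in machine arithmetic, lift to the balanced residue.
[cite: Berkowitz1984, §2] -/
def detZ (A : List (List ℤ)) : ℤ := intDet (modulusOf A) A

/-- **`detZ` is polynomial-time on codes.** [cite: Berkowitz1984, §2] [cite: AroraBarak2009, §1.3] -/
theorem detZ_codeFP : CodeFP zmatE intE detZ := by
  have hN : CodeFP zmatE natE modulusOf := modulusOf_codeFP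
  have hred : CodeFP zmatE matE (fun A => A.map (·.map (zmodNat (modulusOf A)))) :=
    (reduce_codeFP.comp (hN.pair (CodeFP.id _))).congr fun _ => rfl
  have hx : CodeFP zmatE natE (fun A => Berkowitz.det (RingOps.modSucc (modulusOf A))
      (A.map (·.map (zmodNat (modulusOf A))))) := (det_codeFP.comp (hN.pair hred)).congr fun _ => rfl
  have htest : CodeFP zmatE bitE (fun A => decide (2 * Berkowitz.det (RingOps.modSucc (modulusOf A))
      (A.map (·.map (zmodNat (modulusOf A)))) ≤ modulusOf A)) :=
    (natLe.comp ((natMul.comp ((const _ 2).pair hx)).pair hN)).congr fun _ => rfl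
  have hxz : CodeFP zmatE intE (fun A => ((Berkowitz.det (RingOps.modSucc (modulusOf A))
      (A.map (·.map (zmodNat (modulusOf A)))) : ℕ) : ℤ)) := (intOfNat.comp hx).congr fun _ => rfl
  have hsub : CodeFP zmatE intE (fun A => ((Berkowitz.det (RingOps.modSucc (modulusOf A))
      (A.map (·.map (zmodNat (modulusOf A)))) : ℕ) : ℤ) - ((modulusOf A : ℕ) + 1 : ℤ)) :=
    (intSub.comp (hxz.pair (intAdd.comp ((intOfNat.comp hN).pair (const _ (1 : ℤ)))))).congr fun _ => rfl
  refine (htest.ite hxz hsub).congr fun A => ?_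
  rw [detZ, intDet, balancedLift]
  by_cases h : 2 * Berkowitz.det (RingOps.modSucc (modulusOf A)) (A.map (·.map (zmodNat (modulusOf A)))) ≤ modulusOf A
  · rw [if_pos (decide_eq_true h), if_pos h]
  · rw [if_neg (by rw [decide_eq_true_iff]; exact h), if_neg h]

/-! ### Exactness on genuine matrices -/

/-- An integer is shorter than its canonical code: `|z| < 2^{|intE z|}`. [folklore] -/
theorem natAbs_lt_two_pow_length (z : ℤ) : z.natAbs < 2 ^ (intE z).length := by
  have h1 : z.natAbs < 2 ^ (natE z.natAbs).length := by
    rw [length_natE_eq_size]; exact Nat.lt_size_self _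
  refine lt_of_lt_of_le h1 (Nat.pow_le_pow_right (by norm_num) ?_)
  change (natE z.natAbs).length ≤ (dpEnc z).length
  rw [dpEnc, length_boolPair]
  rcases le_total 0 z with hz | hz
  · have : z.natAbs = z.toNat := by omega
    rw [this]
    change (encodeNat z.toNat).length ≤ 2 * (encodeNat z.toNat).length + 2 + (encodeNat (-z).toNat).length
    omega
  · have : z.natAbs = (-z).toNat := by omega
    rw [this]
    change (encodeNat (-z).toNat).length ≤ 2 * (encodeNat z.toNat).length + 2 + (encodeNat (-z).toNat).length
    omega

/-- Every entry of a matrix is shorter than the code of its row list. [folklore] -/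
theorem natAbs_lt_two_pow_codeLen {n m : ℕ} (M : _root_.Matrix (Fin n) (Fin m) ℤ) (i : Fin n) (j : Fin m) :
    (M i j).natAbs < 2 ^ codeLen (rows M) := by
  refine lt_of_lt_of_le (natAbs_lt_two_pow_length (M i j)) (Nat.pow_le_pow_right (by norm_num) ?_)
  have hrow : List.ofFn (M i) ∈ rows M := by
    rw [rows, List.mem_ofFn]; exact ⟨i, rfl⟩
  have hij : M i j ∈ List.ofFn (M i) := by
    rw [List.mem_ofFn]; exact ⟨j, rfl⟩
  have h1 := length_item_le_length_rawE intE hij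
  have h2 := length_item_le_length_rawE (rawE intE) hrow
  rw [codeLen]
  change (intE (M i j)).length ≤ (rawE (rawE intE) (rows M)).length
  omega

/-- The dimension is at most the code length. [folklore] -/
theorem dim_le_codeLen {n m : ℕ} (M : _root_.Matrix (Fin n) (Fin m) ℤ) : n ≤ codeLen (rows M) := by
  have h := length_le_length_rawE (rawE intE) (rows M)
  rwa [length_rows] at h

/-- **The size condition holds**: `2 · n! · (2^L)ⁿ ≤ 4^{(L+1)²} - 1` for `n ≤ L`. [folklore] -/
theorem two_mul_factorial_mul_pow_le {n L : ℕ} (hn : n ≤ L) :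
    2 * (Nat.factorial n * (2 ^ L) ^ n) ≤ 4 ^ ((L + 1) * (L + 1)) - 1 := by
  have h1 : Nat.factorial n ≤ (2 ^ L) ^ L := by
    rcases Nat.eq_zero_or_pos L with rfl | hL
    · obtain rfl : n = 0 := by omega
      simp
    · calc Nat.factorial n ≤ n ^ n := Nat.factorial_le_pow n
        _ ≤ L ^ n := Nat.pow_le_pow_left hn n
        _ ≤ L ^ L := Nat.pow_le_pow_right hL hn
        _ ≤ (2 ^ L) ^ L := Nat.pow_le_pow_left (Nat.lt_two_pow_self).le L
  have h2 : (2 ^ L) ^ n ≤ (2 ^ L) ^ L := Nat.pow_le_pow_right (Nat.one_le_two_pow) hn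
  have h3 : 2 * (Nat.factorial n * (2 ^ L) ^ n) ≤ 2 ^ (2 * L * L + 1) := by
    calc 2 * (Nat.factorial n * (2 ^ L) ^ n) ≤ 2 * ((2 ^ L) ^ L * (2 ^ L) ^ L) := by gcongr
      _ = 2 ^ (2 * L * L + 1) := by rw [← pow_mul, ← pow_add, pow_succ]; ring_nf
  have h4 : 2 ^ (2 * L * L + 1) + 1 ≤ 4 ^ ((L + 1) * (L + 1)) := by
    have : (4 : ℕ) ^ ((L + 1) * (L + 1)) = 2 ^ (2 * L * L + 1) * 2 ^ (4 * L + 1) := by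
      rw [show (4 : ℕ) = 2 ^ 2 by norm_num, ← pow_mul, ← pow_add]; ring_nf
    rw [this]
    have h5 : 2 ≤ 2 ^ (4 * L + 1) := by
      calc (2 : ℕ) = 2 ^ 1 := by norm_num
        _ ≤ 2 ^ (4 * L + 1) := Nat.pow_le_pow_right (by norm_num) (by omega)
    have h6 : 1 ≤ 2 ^ (2 * L * L + 1) := Nat.one_le_two_pow
    nlinarith
  omega

/-- **The polynomial-time integer determinant is exact**: on the code of the row list of a square
integer matrix, `detZ` returns its determinant. [cite: Berkowitz1984, §2] -/
theorem detZ_rows {n : ℕ} (M : _root_.Matrix (Fin n) (Fin n) ℤ) : detZ (rows M) = M.det := by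
  rw [detZ]
  refine intDet_rows M (T := 2 ^ codeLen (rows M)) (fun i j => ?_) ?_
  · have h := natAbs_lt_two_pow_codeLen M i j
    rw [Int.abs_eq_natAbs]
    exact_mod_cast h.le
  · exact two_mul_factorial_mul_pow_le (dim_le_codeLen M)

end IntDetFP

end Literature.Computability.Complexity
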